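import Summits.AtomisticToContinuum.FouriersLaw.Theses.EmbeddedDrudeMourre
import Summits.AtomisticToContinuum.FouriersLaw.Theorems.FGRGap.Negative.LoadBearing
import Summits.AtomisticToContinuum.FouriersLaw.Theorems.FGRGap.Negative.OnsiteReduction

/-!
# Line `fold-jet-rigidity` for crux `EmbeddedDrudeMourre.FGRGap` (stmt-AtomisticToContinuum-12595)
# — LEAD'S RESHAPED SKELETON (prover-line-stmt-AtomisticToContinuum-12595-0, 2026-08-16)

Crux (rank 3 of route EmbeddedDrudeMourre, FIXED, concluded BY NAME in `FGRGap_of`):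
`FGRGap := ∀ ω₂ a b : ℝ, 0 < ω₂ → 0 < a → 0 < b → PhononBoltzmann.HasOddSectorGap ω₂ a b`.

ARCHITECTURE (the planner's fold-jet composition, with (i) the C³ jet lever reshaped to the ODD C¹
classification — the only instance the crux consumes, documented as the reshape option in the planner's
skeleton — and (ii) the common infrastructure of S2/S3/S4 factored out as two structural stubs taken as
HYPOTHESES by the others, so that all seven stubs can be proved in parallel):

  FGRGap ⇐ S4b closing [ S4a lsc , S3 essential gap , no odd null vector ⇐ (S2 bootstrap + S1 odd C¹) ],
  every geometric stub fed by GA (branch structure) and GB (fibre genericity).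

* GA `stub_branchStructure` — TWO-ROOT STRUCTURE of the resonant set of the pinned band: there is a partner
  map `h` (cell-valued, `Ω(k₁,h,k₃) = 0`, doubly `2π`-periodic, `h k k = k`) such that off the diagonal
  `resonantSet ω₂ k₁ k₃ = {k₃ mod 2π, h k₁ k₃}`, the branch is trivial (`h ≡ k₃`) EXACTLY on the equal-velocity
  curve `v(k₃) = v(k₁)`, off that curve the resolved energy delta is non-degenerate (`v(h) ≠ v(k₄)`), `h` is
  jointly measurable, and near every point off the equal-velocity curve `h` has a real-analytic lift `φ` with
  the implicit derivatives `∂₁φ = (v₄-v₁)/(v₂-v₄)`, `∂₃φ = (v₃-v₄)/(v₂-v₄)` (`v = groupVelocity ω₂`).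
  Mechanism: for `t = k₃ - k₁ ∉ 2πℤ`, `Ω = D_t(k₂) - D_t(k₃)` with `D_t(x) = ω(x) - ω(x-t)`; `D_t' = v - v(·-t)`
  vanishes iff `x - t = x*` (velocity involution of the unimodal odd `v = sin/ω`), i.e. at exactly TWO points of
  the circle, both nondegenerate, so `D_t` is strictly monotone on the two complementary arcs.
* GB `stub_fibreGenericity` — every fibre `{k₁} × 𝕋` carries a GENERAL-POSITION resonance (all six group
  velocities pairwise distinct) with non-vanishing unit vertex `1 + 16r∏ sin(k_j/2) ≠ 0` for any given `r ≥ 0`;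
  the equal-velocity curve and the vertex zero set are Lebesgue-null. Mechanism: along a fibre each of the six
  coincidences `v_i ≡ v_j` on an open arc forces an impossible identity (`E_P ≡ const`, `D_d ≡ const`,
  `v` symmetric about a point, or `h ≡ k₃` off the curve via the swap symmetry); analyticity ⇒ isolated zeros;
  near the diagonal `∏ sin(k_j/2) → sin²(k₁/2)sin²(L/2) ≥ 0`.
* S1 `stub_noOddC1Invariant` — every odd `C¹` `2π`-periodic collisional invariant vanishes (parity resonance
  `(k,π-k;-k,π+k)` ⇒ `ψ'` even about `π/2`; order-`t` grazing law `ψ'(k*) = ψ'(k)`; orbit descent along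
  `ρ = (π-·)∘*`, no interior fixed point). VERBATIM the statement of line log-coercive-compact-resolvent's stub 6.
* S2 `stub_nullVectorRegularity` — GA ⇒ GB ⇒ an odd `L²` null vector of `q` (`a > 0`, `b ≥ 0`) agrees a.e. on the
  cell with an odd `C¹` periodic collisional invariant (LS08 §5 averaging bootstrap along `k₃ ↦ h`, `k₃ ↦ k₄`).
* S3 `stub_oddEssentialGap` — GA ⇒ GB ⇒ (`a > 0`, `b ≥ 0`) `liminf q ≥ v₀ > 0` along weakly-null odd unit
  sequences (truncation to finitely many general-position rectangles; diagonal collision densities bounded below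
  on every fibre BECAUSE `a > 0`; the six cross terms have bounded kernels and die along weakly-null sequences).
  HARDEST — held by the lead.
* S4a `stub_formLowerSemicontinuous` — GA ⇒ `q(f) ≤ liminf q(F n)` along a.e.-convergent periodic measurable
  sequences (Fatou; the pull-backs `(k₁,k₃) ↦ h, k₄` are submersions off the null equal-velocity curve).
* S4b `stub_gapClosing` — lsc ∧ essential gap ∧ (no odd null vector) ⇒ gap (normalise a violating sequence,
  weak compactness of the `L²(cell)` ball, Banach–Saks/Cesàro + convexity of `q` + lsc). Pure functional
  analysis, parameter-free.

CONVENTIONS. Every stub is stated over TREE VOCABULARY ONLY (no local `def`), fully unfolded, so that each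
lands verbatim as `Summits/AtomisticToContinuum/FouriersLaw/Theorems/EmbeddedDrudeMourreFGRGap<Stub>.lean`
(`ledger propose … --supports stmt-AtomisticToContinuum-12595`). The bundles "GA-conclusion" and
"GB-conclusion" are pasted byte-identically wherever they occur (generated from one source string).
`sorry` occurs only in the seven `stub_*`; `FGRGap_of` has no `sorry` of its own.

DISPROOF USED (`Cruxes/FGRGap/Disproof.lean`, cdisprove gen 2 c1, NO KILL): periodicity (witness `k ↦ k`),
oddness (witness `1`), `0 < ω₂` (junk band), `(a,b) ≠ 0` are hypotheses where the refuter showed them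
load-bearing; `0 < a` is USED at S3 only (at `a = 0` the fibre `k₁ = 0` has vertex `16b·sin(0)·… ≡ 0`, the
refuter's gapless near-miss); `0 < b` is used nowhere (`0 ≤ b`), consistent with `onsite_of_crux`.
-/

noncomputable section

-- Helper/stub files: copy these four `open` lines verbatim.
open MeasureTheory Set Real Filter Topology
open scoped ENNReal
open Literature.MathematicalPhysics.KineticTheory.PhononBoltzmann
open Summit.AtomisticToContinuum.FouriersLaw.Theorems.FGRGap

namespace Summit.AtomisticToContinuum.FouriersLaw.Cruxes.FGRGap.FoldJetRigidity

/-- The crux, unfolded (pins this file's reading of it definitionally). -/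
theorem fgrGap_iff :
    Summit.AtomisticToContinuum.FouriersLaw.Theses.EmbeddedDrudeMourre.FGRGap ↔
      ∀ ω₂ a b : ℝ, 0 < ω₂ → 0 < a → 0 < b → HasOddSectorGap ω₂ a b := Iff.rfl

/-! ## 1. The stubs -/

/-- **GA — BRANCH STRUCTURE (two-root structure of the resonant set; the partner map `h`).**
For `ω₂ > 0` there is `h : ℝ → ℝ → ℝ` with: values in the cell `(-π, π]`; `Ω(k₁, h k₁ k₃, k₃) = 0`;
`2π`-periodic in each argument; `h k k = k` on the cell; OFF THE DIAGONAL (`k₃ - k₁ ∉ 2πℤ`) the resonant set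
is `{k₃ mod 2π, h k₁ k₃}`; the branch is trivial iff `v(k₃) = v(k₁)` (equal group velocity); off that curve
`v(h) ≠ v(k₄)` (`k₄ = k₁ + h - k₃`; the resolved Jacobian is not junk); `h` is jointly measurable; and near
every point with `v(k₃) ≠ v(k₁)` there is a real-analytic LIFT `φ ≡ h (mod 2π)`, `φ = h` at the point, on a
neighbourhood avoiding the equal-velocity curve, with the implicit derivative
`Dφ = ((v₄-v₁) dk₁ + (v₃-v₄) dk₃)/(v₂-v₄)`, `v₂ = v(φ)`, `v₄ = v(k₁+φ-k₃)`.
Why true: `Ω(k₁,k₂,k₃) = D_t(k₂) - D_t(k₃)`, `t = k₃ - k₁`, `D_t(x) = ω(x) - ω(x-t)`; `D_t'(x) = v(x) - v(x-t)`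
vanishes iff `x - t ≡ x*` where `*` is the velocity involution of `v = sin/ω` (odd, `2π`-periodic, strictly
increasing on `[-k_m,k_m]`, strictly decreasing on `[k_m, 2π-k_m]`, `cos k_m = c₋ = ((ω₂+2)-√((ω₂+2)²-4))/2`,
`v' = -(cos k-c₋)(cos k-c₊)/ω³`); `x ↦ x - x*` lifts to a strictly increasing continuous map gaining `4π` per
turn, so for `t ∉ 2πℤ` `D_t` has EXACTLY TWO critical points, both nondegenerate (`D_t'' = v'(x) - v'(x*) ≠ 0`),
hence is strictly monotone on the two arcs between them: `D_t(k₂) = D_t(k₃)` has exactly the solutions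
`k₂ ≡ k₃` and `k₂ = h`, coinciding iff `k₃` is critical iff `v(k₃) = v(k₁)`. Off that curve `∂₂Ω(k₁,h,k₃) =
D_t'(h) ≠ 0`, so the analytic implicit function theorem (`Literature.Analysis.Calculus.analyticAt_implicitFunction`,
`exists_implicit_of_partial_ne_zero`, `hasFDerivAt_of_implicit`; `analyticAt_resonanceFn`,
`hasDerivAt_resonanceFn`, `hasDerivAt_dispersion`) gives the lift and `∂₁φ = -∂₁Ω/∂₂Ω = (v₄-v₁)/(v₂-v₄)`,
`∂₃φ = -∂₃Ω/∂₂Ω = (v₃-v₄)/(v₂-v₄)`; measurability: `h = toIocMod ∘ φ` locally, diagonal and curve are null/closed.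
Size L. [AokiLukkarinenSpohn2006 §4 (4.3)-(4.8); Lukkarinen2016 §2.2.4 ("continuous, one-to-one")] -/
theorem stub_branchStructure :
    ∀ ω₂ : ℝ, 0 < ω₂ → ∃ h : ℝ → ℝ → ℝ,
      ((∀ k₁ k₃ : ℝ, h k₁ k₃ ∈ Set.Ioc (-π) π) ∧
        (∀ k₁ k₃ : ℝ, resonanceFn ω₂ k₁ (h k₁ k₃) k₃ = 0) ∧
        (∀ k₁ k₃ : ℝ, h (k₁ + 2 * π) k₃ = h k₁ k₃ ∧ h k₁ (k₃ + 2 * π) = h k₁ k₃) ∧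
        (∀ k : ℝ, k ∈ Set.Ioc (-π) π → h k k = k) ∧
        (∀ k₁ k₃ : ℝ, (∀ n : ℤ, k₃ - k₁ ≠ n * (2 * π)) →
          resonantSet ω₂ k₁ k₃ = {toIocMod Real.two_pi_pos (-π) k₃, h k₁ k₃}) ∧
        (∀ k₁ k₃ : ℝ, (∀ n : ℤ, k₃ - k₁ ≠ n * (2 * π)) →
          (h k₁ k₃ = toIocMod Real.two_pi_pos (-π) k₃ ↔ groupVelocity ω₂ k₃ = groupVelocity ω₂ k₁)) ∧
        (∀ k₁ k₃ : ℝ, groupVelocity ω₂ k₃ ≠ groupVelocity ω₂ k₁ →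
          groupVelocity ω₂ (h k₁ k₃) ≠ groupVelocity ω₂ (k₁ + h k₁ k₃ - k₃)) ∧
        Measurable (Function.uncurry h) ∧
        (∀ k₁ k₃ : ℝ, groupVelocity ω₂ k₃ ≠ groupVelocity ω₂ k₁ →
          ∃ (φ : ℝ × ℝ → ℝ) (U : Set (ℝ × ℝ)), U ∈ 𝓝 (k₁, k₃) ∧ AnalyticOnNhd ℝ φ U ∧
            φ (k₁, k₃) = h k₁ k₃ ∧ (∀ p ∈ U, ∃ n : ℤ, φ p = h p.1 p.2 + n * (2 * π)) ∧
            (∀ p ∈ U, groupVelocity ω₂ p.2 ≠ groupVelocity ω₂ p.1) ∧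
            (∀ p ∈ U, HasStrictFDerivAt φ (((groupVelocity ω₂ (p.1 + φ p - p.2) - groupVelocity ω₂ p.1) /
              (groupVelocity ω₂ (φ p) - groupVelocity ω₂ (p.1 + φ p - p.2))) • ContinuousLinearMap.fst ℝ ℝ ℝ +
            ((groupVelocity ω₂ p.2 - groupVelocity ω₂ (p.1 + φ p - p.2)) /
              (groupVelocity ω₂ (φ p) - groupVelocity ω₂ (p.1 + φ p - p.2))) • ContinuousLinearMap.snd ℝ ℝ ℝ) p))) := by
  sorry

/-- **GB — FIBRE GENERICITY (general-position resonances on every fibre; null exceptional sets).**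
For `ω₂ > 0` and any `h` with the GA properties: (1) for every `k₁` and every `r ≥ 0` there is `k₃` such
that the resonance `(k₁, h; k₃, k₄)` is in GENERAL POSITION (all six group velocities pairwise distinct — so
every coordinate pair `(k_i,k_j)` is a local chart of the resonant surface, Jacobians = ratios of velocity
differences) and has unit vertex `vertex 1 r = 1 + 16r∏ sin(k_j/2) ≠ 0`; (2) the equal-velocity curve
`{v(k₃) = v(k₁)}` is Lebesgue-null in `ℝ²`; (3) for `a > 0`, `b ≥ 0` the vertex zero set
`{vertex a b k₁ h k₃ = 0}` is Lebesgue-null.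
Why true: (2) fibrewise finite (`v` analytic non-constant) + Tonelli; (3) fibrewise: `vertex` is analytic
along the fibre through the local lifts (the product `∏ sin(k_j/2)` is lift-independent: two factors flip
together) and tends to `≥ a > 0` at the diagonal ends (`∏ → sin²(k₁/2)sin²(L/2)` for any cluster value `L`
of `h`), so its zeros are isolated; (1) on an open sub-arc of a fibre none of the six coincidences can hold
identically: `v₁ ≡ v₃` (isolated), `v₂ ≡ v₄` (excluded off the curve by GA), `v₁ ≡ v₂` or `v₃ ≡ v₄` ⇒ `h`
locally constant ⇒ `k ↦ ω(k) + ω(P-k)` constant on an interval (impossible: `v` would be symmetric about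
`P/2`), `v₁ ≡ v₄` ⇒ `k₄` locally constant ⇒ `D_d` constant for some `d ∉ 2πℤ` (impossible) or `h ≡ k₃`
(excluded), `v₂ ≡ v₃` ⇒ `h ≡ k₃*` ⇒ by the swap symmetry `(k₂,k₁;k₃,k₄)` the point `(k₃*, k₃)` of the chart
lies on the curve where the branch is trivial, forcing `k₁ ≡ k₃` (excluded); analyticity along the fibre
(GA lifts) makes the bad set's complement open dense, and near the diagonal end `1 + 16r∏ → ≥ 1`. Size M/L.
[folklore; LukkarinenSpohn2008 Prop. 2.4 (parity/permutation symmetries of the collision set)] -/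
theorem stub_fibreGenericity :
    ∀ ω₂ : ℝ, 0 < ω₂ → ∀ h : ℝ → ℝ → ℝ,
      ((∀ k₁ k₃ : ℝ, h k₁ k₃ ∈ Set.Ioc (-π) π) ∧
        (∀ k₁ k₃ : ℝ, resonanceFn ω₂ k₁ (h k₁ k₃) k₃ = 0) ∧
        (∀ k₁ k₃ : ℝ, h (k₁ + 2 * π) k₃ = h k₁ k₃ ∧ h k₁ (k₃ + 2 * π) = h k₁ k₃) ∧
        (∀ k : ℝ, k ∈ Set.Ioc (-π) π → h k k = k) ∧
        (∀ k₁ k₃ : ℝ, (∀ n : ℤ, k₃ - k₁ ≠ n * (2 * π)) →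
          resonantSet ω₂ k₁ k₃ = {toIocMod Real.two_pi_pos (-π) k₃, h k₁ k₃}) ∧
        (∀ k₁ k₃ : ℝ, (∀ n : ℤ, k₃ - k₁ ≠ n * (2 * π)) →
          (h k₁ k₃ = toIocMod Real.two_pi_pos (-π) k₃ ↔ groupVelocity ω₂ k₃ = groupVelocity ω₂ k₁)) ∧
        (∀ k₁ k₃ : ℝ, groupVelocity ω₂ k₃ ≠ groupVelocity ω₂ k₁ →
          groupVelocity ω₂ (h k₁ k₃) ≠ groupVelocity ω₂ (k₁ + h k₁ k₃ - k₃)) ∧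
        Measurable (Function.uncurry h) ∧
        (∀ k₁ k₃ : ℝ, groupVelocity ω₂ k₃ ≠ groupVelocity ω₂ k₁ →
          ∃ (φ : ℝ × ℝ → ℝ) (U : Set (ℝ × ℝ)), U ∈ 𝓝 (k₁, k₃) ∧ AnalyticOnNhd ℝ φ U ∧
            φ (k₁, k₃) = h k₁ k₃ ∧ (∀ p ∈ U, ∃ n : ℤ, φ p = h p.1 p.2 + n * (2 * π)) ∧
            (∀ p ∈ U, groupVelocity ω₂ p.2 ≠ groupVelocity ω₂ p.1) ∧
            (∀ p ∈ U, HasStrictFDerivAt φ (((groupVelocity ω₂ (p.1 + φ p - p.2) - groupVelocity ω₂ p.1) /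
              (groupVelocity ω₂ (φ p) - groupVelocity ω₂ (p.1 + φ p - p.2))) • ContinuousLinearMap.fst ℝ ℝ ℝ +
            ((groupVelocity ω₂ p.2 - groupVelocity ω₂ (p.1 + φ p - p.2)) /
              (groupVelocity ω₂ (φ p) - groupVelocity ω₂ (p.1 + φ p - p.2))) • ContinuousLinearMap.snd ℝ ℝ ℝ) p))) →
      ((∀ k₁ r : ℝ, 0 ≤ r → ∃ k₃ : ℝ,
          groupVelocity ω₂ k₁ ≠ groupVelocity ω₂ (h k₁ k₃) ∧ groupVelocity ω₂ k₁ ≠ groupVelocity ω₂ k₃ ∧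
          groupVelocity ω₂ k₁ ≠ groupVelocity ω₂ (k₁ + h k₁ k₃ - k₃) ∧ groupVelocity ω₂ (h k₁ k₃) ≠ groupVelocity ω₂ k₃ ∧
          groupVelocity ω₂ (h k₁ k₃) ≠ groupVelocity ω₂ (k₁ + h k₁ k₃ - k₃) ∧ groupVelocity ω₂ k₃ ≠ groupVelocity ω₂ (k₁ + h k₁ k₃ - k₃) ∧
          vertex 1 r k₁ (h k₁ k₃) k₃ ≠ 0) ∧
        MeasureTheory.volume {p : ℝ × ℝ | groupVelocity ω₂ p.2 = groupVelocity ω₂ p.1} = 0 ∧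
        (∀ a b : ℝ, 0 < a → 0 ≤ b →
          MeasureTheory.volume {p : ℝ × ℝ | vertex a b p.1 (h p.1 p.2) p.2 = 0} = 0)) := by
  sorry

/-- **S1 — NO ODD `C¹` COLLISIONAL INVARIANT** on the pinned band, for every `ω₂ > 0` (VERBATIM the statement
of stub 6 of line log-coercive-compact-resolvent; the reshape of the planner's `stub_foldJetRigidity` to the
only instance the crux consumes). Why true (gen-1 cdisprove `NoOddC1Invariant.lean`, 883 lines, rc 0, to be
re-derived — the evidence store is not mounted in prover jails): (i) PARITY RESONANCE: for every `k`,
`(k, π-k; -k, π+k)` is resonant (`ω(π-k) = ω(π+k)`), so an odd periodic invariant has `ψ(π-k) = -ψ(k)`, hence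
`ψ'(π-k) = ψ'(k)`; (ii) GRAZING LAW: for `k ≠ ±k_m` and small `t ≠ 0` there is a resonance
`(k, K_t; k+t, K_t - t)` with `K_t → k*` (IVT on `Ω(k,·,k+t)/t`, whose `t → 0` limit `v(·) - v(k)` changes
sign at `k*` since `v'(k*) ≠ 0`), and dividing the invariant identity by `t` gives `ψ'(k) = ψ'(k*)` (MVT +
continuity of `ψ'`); (iii) DESCENT: `ρ = (π - ·) ∘ *` maps `[0,π]` to itself, is continuous increasing with
fixed points `0, π` only (`v(π-x) = v(x)` iff `x = π/2 ≠ k_m` since `cos k_m = c₋ > 0`), and `ψ' ∘ ρ = ψ'`;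
iterating, `ψ'` is constant on `[0,π]`, even (ψ odd) ⇒ constant on `[-π,π]` ⇒ `ψ = ck` ⇒ periodicity ⇒ `c = 0`.
Needs the unimodality of `v = sin/ω` (`v' = -(cos k - c₋)(cos k - c₊)/ω³`, `c₋c₊ = 1`, `0 < c₋ < 1 < c₊`).
Size M/L. [AokiLukkarinenSpohn2006 §4 (4.9); LukkarinenSpohn2008 §5] -/
theorem stub_noOddC1Invariant :
    ∀ ω₂ : ℝ, 0 < ω₂ → ∀ ψ : ℝ → ℝ, ContDiff ℝ 1 ψ → Function.Periodic ψ (2 * π) →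
      Function.Odd ψ → IsCollisionalInvariant ω₂ ψ → ∀ k : ℝ, ψ k = 0 := by
  sorry

/-- **S2 — REGULARITY OF ODD NULL VECTORS (averaging bootstrap), fed by GA and GB.** For `ω₂ > 0`, a partner
map `h` with the GA and GB properties, `a > 0`, `b ≥ 0`: an odd `2π`-periodic measurable `f` with
`‖f‖²_{L²(cell)} < ∞` and `q(f) = 0` agrees a.e. on the cell with an odd `C¹` `2π`-periodic collisional invariant.
Why true: `q` is a lower Lebesgue integral; off the (null) diagonal the resonant `finsum` is the exchange term
(`0` for periodic `f`) plus the term at `h` (GA two-root), whose weight `w` is `> 0` off the null sets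
`{v(k₃)=v(k₁)}` (Jacobian, GA) and `{vertex = 0}` (GB); so `q(f) = 0` ⇒ `f(k₁) = f(k₃) + f(k₄) - f(h)` for a.e.
`(k₁,k₃)`. Around the general-position point of the fibre `k₁⁰` (GB, `r = 0`) take a box `I × J` inside the
GA lift's neighbourhood on which `∂₃φ = (v₃-v₄)/(v₂-v₄) ≠ 0` and `∂₃k₄ = (v₃-v₂)/(v₂-v₄) ≠ 0`; average the
identity against a smooth bump in `k₃ ∈ J` and change variables `u = φ(k₁,k₃)`, `u = k₄(k₁,k₃)`
(`MeasureTheory.integral_image_eq_integral_abs_deriv_smul`): `f(k₁)` equals a.e. on `I` an integral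
`∫ f(u) Θ(k₁,u) du` with `Θ` smooth compactly supported — a `C¹` (indeed `C^∞`) function of `k₁`
(`Literature/Analysis/FunctionSpaces/ParametricIntegralSmooth.lean`, `hasFDerivAt_integral_of_dominated_of_fderiv_le`).
Patch the local representatives (they agree a.e. on overlaps, hence everywhere), extend by periodicity, pass the
a.e. identity to EVERY point of the non-trivial sheet by continuity (GA lift; the pull-backs are submersions off
the null curve, `Literature/Analysis/Calculus/SubmersionNullPreimage.lean`) — points with `v(k₃) = v(k₁)` or on the
diagonal are trivial resonances, identities by periodicity — so the representative is a collisional invariant at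
every real resonance (GA two-root + periodicity); finally take the odd part (`IsCollisionalInvariant.oddPart`),
still a.e. equal to the odd `f`. Size L. [LukkarinenSpohn2008 §5 (arXiv:0704.1607 p.16)] -/
theorem stub_nullVectorRegularity :
    ∀ ω₂ : ℝ, 0 < ω₂ → ∀ h : ℝ → ℝ → ℝ,
      ((∀ k₁ k₃ : ℝ, h k₁ k₃ ∈ Set.Ioc (-π) π) ∧
        (∀ k₁ k₃ : ℝ, resonanceFn ω₂ k₁ (h k₁ k₃) k₃ = 0) ∧
        (∀ k₁ k₃ : ℝ, h (k₁ + 2 * π) k₃ = h k₁ k₃ ∧ h k₁ (k₃ + 2 * π) = h k₁ k₃) ∧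
        (∀ k : ℝ, k ∈ Set.Ioc (-π) π → h k k = k) ∧
        (∀ k₁ k₃ : ℝ, (∀ n : ℤ, k₃ - k₁ ≠ n * (2 * π)) →
          resonantSet ω₂ k₁ k₃ = {toIocMod Real.two_pi_pos (-π) k₃, h k₁ k₃}) ∧
        (∀ k₁ k₃ : ℝ, (∀ n : ℤ, k₃ - k₁ ≠ n * (2 * π)) →
          (h k₁ k₃ = toIocMod Real.two_pi_pos (-π) k₃ ↔ groupVelocity ω₂ k₃ = groupVelocity ω₂ k₁)) ∧
        (∀ k₁ k₃ : ℝ, groupVelocity ω₂ k₃ ≠ groupVelocity ω₂ k₁ →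
          groupVelocity ω₂ (h k₁ k₃) ≠ groupVelocity ω₂ (k₁ + h k₁ k₃ - k₃)) ∧
        Measurable (Function.uncurry h) ∧
        (∀ k₁ k₃ : ℝ, groupVelocity ω₂ k₃ ≠ groupVelocity ω₂ k₁ →
          ∃ (φ : ℝ × ℝ → ℝ) (U : Set (ℝ × ℝ)), U ∈ 𝓝 (k₁, k₃) ∧ AnalyticOnNhd ℝ φ U ∧
            φ (k₁, k₃) = h k₁ k₃ ∧ (∀ p ∈ U, ∃ n : ℤ, φ p = h p.1 p.2 + n * (2 * π)) ∧
            (∀ p ∈ U, groupVelocity ω₂ p.2 ≠ groupVelocity ω₂ p.1) ∧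
            (∀ p ∈ U, HasStrictFDerivAt φ (((groupVelocity ω₂ (p.1 + φ p - p.2) - groupVelocity ω₂ p.1) /
              (groupVelocity ω₂ (φ p) - groupVelocity ω₂ (p.1 + φ p - p.2))) • ContinuousLinearMap.fst ℝ ℝ ℝ +
            ((groupVelocity ω₂ p.2 - groupVelocity ω₂ (p.1 + φ p - p.2)) /
              (groupVelocity ω₂ (φ p) - groupVelocity ω₂ (p.1 + φ p - p.2))) • ContinuousLinearMap.snd ℝ ℝ ℝ) p))) →
      ((∀ k₁ r : ℝ, 0 ≤ r → ∃ k₃ : ℝ,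
          groupVelocity ω₂ k₁ ≠ groupVelocity ω₂ (h k₁ k₃) ∧ groupVelocity ω₂ k₁ ≠ groupVelocity ω₂ k₃ ∧
          groupVelocity ω₂ k₁ ≠ groupVelocity ω₂ (k₁ + h k₁ k₃ - k₃) ∧ groupVelocity ω₂ (h k₁ k₃) ≠ groupVelocity ω₂ k₃ ∧
          groupVelocity ω₂ (h k₁ k₃) ≠ groupVelocity ω₂ (k₁ + h k₁ k₃ - k₃) ∧ groupVelocity ω₂ k₃ ≠ groupVelocity ω₂ (k₁ + h k₁ k₃ - k₃) ∧
          vertex 1 r k₁ (h k₁ k₃) k₃ ≠ 0) ∧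
        MeasureTheory.volume {p : ℝ × ℝ | groupVelocity ω₂ p.2 = groupVelocity ω₂ p.1} = 0 ∧
        (∀ a b : ℝ, 0 < a → 0 ≤ b →
          MeasureTheory.volume {p : ℝ × ℝ | vertex a b p.1 (h p.1 p.2) p.2 = 0} = 0)) →
      ∀ a b : ℝ, 0 < a → 0 ≤ b → ∀ f : ℝ → ℝ,
        Function.Periodic f (2 * π) → Measurable f → Function.Odd f → cellNormSq f < ∞ →
          boltzmannForm ω₂ a b f = 0 →
            ∃ ψ : ℝ → ℝ, ContDiff ℝ 1 ψ ∧ Function.Periodic ψ (2 * π) ∧ Function.Odd ψ ∧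
              IsCollisionalInvariant ω₂ ψ ∧
                f =ᵐ[MeasureTheory.volume.restrict (Set.Ioc (-π) π)] ψ := by
  sorry

/-- **S3 — ODD ESSENTIAL GAP (the analytic estimate; uses `0 < a`), fed by GA and GB. HELD BY THE LEAD.**
For `ω₂ > 0`, a partner map `h` with the GA and GB properties, `a > 0`, `b ≥ 0`: there is `v₀ > 0` such that
every WEAKLY-NULL sequence of odd `2π`-periodic measurable unit vectors of `L²(cell)` has `liminf q(f_n) ≥ v₀`.
Proof plan: for every `k₁⁰ ∈ [-π,π]` GB (`r = b/a`) gives a general-position resonance with `vertex a b ≠ 0`;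
by the GA lift and the inverse function theorem choose a closed box `I × J ∋ (k₁⁰,k₃⁰)` on which `φ` is analytic,
the six velocity differences and `|vertex|` are bounded away from `0`, `w(k₁,φ,k₃)` is continuous and bounded,
and the five non-trivial pair maps `(k₁,k₃) ↦ (k₁,φ), (k₁,k₄), (φ,k₃), (k₄,k₃), (φ,k₄)` are injective with
Jacobians `∂₃φ, ∂₃φ-1, ∂₁φ, 1+∂₁φ, -(∂₁φ+∂₃φ) = (v₃-v₁)/(v₂-v₄)` bounded away from `0`; finitely many boxes have
`I`'s covering `[-π,π]` (compactness). Then `q(f) ≥ ¼ N⁻¹ Σ_boxes ∫∫_{I×J} w (f₁+f₂-f₃-f₄)²` (GA two-root: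
drop the exchange root and the complement; `N` = overlap count), and on each box the square expands into four
diagonal terms `≥ 0` — the first being `∫_I ν(k₁) f(k₁)²` with `ν(k₁) = ∫_J w ≥ ν₀ > 0` — and six cross terms
`∫∫ K_ij f(x)f(y)` whose kernels, after the changes of variables above
(`MeasureTheory.integral_image_eq_integral_abs_deriv_smul`, `…_abs_det_fderiv_smul`) and folding into the cell by
periodicity, are bounded and supported in a bounded set: along a weakly-null unit sequence
`x ↦ ∫ K(x,y) f_n(y) dy → 0` pointwise with a uniform bound, so by dominated convergence and Cauchy–Schwarz every
cross term tends to `0`, whence `liminf q(f_n) ≥ ¼N⁻¹ ν₀ · liminf Σ ∫_I f_n² ≥ ¼ N⁻¹ ν₀` (the `I`'s cover the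
cell, `‖f_n‖² = 1`). HONOURS `0 < a` (`not_hasOddSectorGap_zero_onsite`). Size XL.
[Lukkarinen2016 §3.4 (arXiv:1509.06036 p.25); AokiLukkarinenSpohn2006 (4.11)] -/
theorem stub_oddEssentialGap :
    ∀ ω₂ : ℝ, 0 < ω₂ → ∀ h : ℝ → ℝ → ℝ,
      ((∀ k₁ k₃ : ℝ, h k₁ k₃ ∈ Set.Ioc (-π) π) ∧
        (∀ k₁ k₃ : ℝ, resonanceFn ω₂ k₁ (h k₁ k₃) k₃ = 0) ∧
        (∀ k₁ k₃ : ℝ, h (k₁ + 2 * π) k₃ = h k₁ k₃ ∧ h k₁ (k₃ + 2 * π) = h k₁ k₃) ∧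
        (∀ k : ℝ, k ∈ Set.Ioc (-π) π → h k k = k) ∧
        (∀ k₁ k₃ : ℝ, (∀ n : ℤ, k₃ - k₁ ≠ n * (2 * π)) →
          resonantSet ω₂ k₁ k₃ = {toIocMod Real.two_pi_pos (-π) k₃, h k₁ k₃}) ∧
        (∀ k₁ k₃ : ℝ, (∀ n : ℤ, k₃ - k₁ ≠ n * (2 * π)) →
          (h k₁ k₃ = toIocMod Real.two_pi_pos (-π) k₃ ↔ groupVelocity ω₂ k₃ = groupVelocity ω₂ k₁)) ∧
        (∀ k₁ k₃ : ℝ, groupVelocity ω₂ k₃ ≠ groupVelocity ω₂ k₁ →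
          groupVelocity ω₂ (h k₁ k₃) ≠ groupVelocity ω₂ (k₁ + h k₁ k₃ - k₃)) ∧
        Measurable (Function.uncurry h) ∧
        (∀ k₁ k₃ : ℝ, groupVelocity ω₂ k₃ ≠ groupVelocity ω₂ k₁ →
          ∃ (φ : ℝ × ℝ → ℝ) (U : Set (ℝ × ℝ)), U ∈ 𝓝 (k₁, k₃) ∧ AnalyticOnNhd ℝ φ U ∧
            φ (k₁, k₃) = h k₁ k₃ ∧ (∀ p ∈ U, ∃ n : ℤ, φ p = h p.1 p.2 + n * (2 * π)) ∧
            (∀ p ∈ U, groupVelocity ω₂ p.2 ≠ groupVelocity ω₂ p.1) ∧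
            (∀ p ∈ U, HasStrictFDerivAt φ (((groupVelocity ω₂ (p.1 + φ p - p.2) - groupVelocity ω₂ p.1) /
              (groupVelocity ω₂ (φ p) - groupVelocity ω₂ (p.1 + φ p - p.2))) • ContinuousLinearMap.fst ℝ ℝ ℝ +
            ((groupVelocity ω₂ p.2 - groupVelocity ω₂ (p.1 + φ p - p.2)) /
              (groupVelocity ω₂ (φ p) - groupVelocity ω₂ (p.1 + φ p - p.2))) • ContinuousLinearMap.snd ℝ ℝ ℝ) p))) →
      ((∀ k₁ r : ℝ, 0 ≤ r → ∃ k₃ : ℝ,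
          groupVelocity ω₂ k₁ ≠ groupVelocity ω₂ (h k₁ k₃) ∧ groupVelocity ω₂ k₁ ≠ groupVelocity ω₂ k₃ ∧
          groupVelocity ω₂ k₁ ≠ groupVelocity ω₂ (k₁ + h k₁ k₃ - k₃) ∧ groupVelocity ω₂ (h k₁ k₃) ≠ groupVelocity ω₂ k₃ ∧
          groupVelocity ω₂ (h k₁ k₃) ≠ groupVelocity ω₂ (k₁ + h k₁ k₃ - k₃) ∧ groupVelocity ω₂ k₃ ≠ groupVelocity ω₂ (k₁ + h k₁ k₃ - k₃) ∧
          vertex 1 r k₁ (h k₁ k₃) k₃ ≠ 0) ∧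
        MeasureTheory.volume {p : ℝ × ℝ | groupVelocity ω₂ p.2 = groupVelocity ω₂ p.1} = 0 ∧
        (∀ a b : ℝ, 0 < a → 0 ≤ b →
          MeasureTheory.volume {p : ℝ × ℝ | vertex a b p.1 (h p.1 p.2) p.2 = 0} = 0)) →
      ∀ a b : ℝ, 0 < a → 0 ≤ b →
        (∃ v₀ : ℝ, 0 < v₀ ∧
          ∀ f : ℕ → ℝ → ℝ, (∀ n, Function.Periodic (f n) (2 * π)) → (∀ n, Measurable (f n)) →
            (∀ n, Function.Odd (f n)) → (∀ n, cellNormSq (f n) = 1) →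
              (∀ φ : ℝ → ℝ, Measurable φ → cellNormSq φ < ∞ →
                  Filter.Tendsto (fun n => cellPairing φ (f n)) Filter.atTop (nhds 0)) →
                ENNReal.ofReal v₀ ≤ Filter.liminf (fun n => boltzmannForm ω₂ a b (f n)) Filter.atTop) := by
  sorry

/-- **S4a — LOWER SEMICONTINUITY OF THE FORM along a.e.-convergent sequences, fed by GA** (any real `a, b`):
if periodic measurable `F n → f` a.e. on the cell then `q(f) ≤ liminf q(F n)`. Why true: a.e. convergence on the
cell is a.e. convergence on `ℝ` (periodicity, countably many translates); off the null diagonal the resonant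
`finsum` is the exchange term `0` plus the `h`-term (GA), and the weight `w ≥ 0` does not depend on `n`; the
brackets converge at a.e. `(k₁,k₃)` because the pull-backs `p ↦ φ(p)` and `p ↦ p.1 + φ(p) - p.2` of the GA lifts
are SUBMERSIONS off the null equal-velocity curve (`∇φ = 0` or `∇k₄ = 0` would force `v₁ = v₃`), so they pull
null sets back to null sets (`Literature.Analysis.Calculus.measure_inter_preimage_null_of_submersion`; cover the
open complement of the curve by countably many lift neighbourhoods); conclude by Fatou
(`MeasureTheory.lintegral_liminf_le`) in `k₃` then in `k₁`, measurability of `(k₁,k₃) ↦ w(k₁,h,k₃)·bracket²` from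
the joint measurability of `h` (GA). This is the statement `FormLowerSemicontinuousAt` of line
log-coercive-compact-resolvent (its stub 3), here with the branch supplied. Size L. [folklore (Fatou)] -/
theorem stub_formLowerSemicontinuous :
    ∀ ω₂ : ℝ, 0 < ω₂ → ∀ h : ℝ → ℝ → ℝ,
      ((∀ k₁ k₃ : ℝ, h k₁ k₃ ∈ Set.Ioc (-π) π) ∧
        (∀ k₁ k₃ : ℝ, resonanceFn ω₂ k₁ (h k₁ k₃) k₃ = 0) ∧
        (∀ k₁ k₃ : ℝ, h (k₁ + 2 * π) k₃ = h k₁ k₃ ∧ h k₁ (k₃ + 2 * π) = h k₁ k₃) ∧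
        (∀ k : ℝ, k ∈ Set.Ioc (-π) π → h k k = k) ∧
        (∀ k₁ k₃ : ℝ, (∀ n : ℤ, k₃ - k₁ ≠ n * (2 * π)) →
          resonantSet ω₂ k₁ k₃ = {toIocMod Real.two_pi_pos (-π) k₃, h k₁ k₃}) ∧
        (∀ k₁ k₃ : ℝ, (∀ n : ℤ, k₃ - k₁ ≠ n * (2 * π)) →
          (h k₁ k₃ = toIocMod Real.two_pi_pos (-π) k₃ ↔ groupVelocity ω₂ k₃ = groupVelocity ω₂ k₁)) ∧
        (∀ k₁ k₃ : ℝ, groupVelocity ω₂ k₃ ≠ groupVelocity ω₂ k₁ →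
          groupVelocity ω₂ (h k₁ k₃) ≠ groupVelocity ω₂ (k₁ + h k₁ k₃ - k₃)) ∧
        Measurable (Function.uncurry h) ∧
        (∀ k₁ k₃ : ℝ, groupVelocity ω₂ k₃ ≠ groupVelocity ω₂ k₁ →
          ∃ (φ : ℝ × ℝ → ℝ) (U : Set (ℝ × ℝ)), U ∈ 𝓝 (k₁, k₃) ∧ AnalyticOnNhd ℝ φ U ∧
            φ (k₁, k₃) = h k₁ k₃ ∧ (∀ p ∈ U, ∃ n : ℤ, φ p = h p.1 p.2 + n * (2 * π)) ∧
            (∀ p ∈ U, groupVelocity ω₂ p.2 ≠ groupVelocity ω₂ p.1) ∧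
            (∀ p ∈ U, HasStrictFDerivAt φ (((groupVelocity ω₂ (p.1 + φ p - p.2) - groupVelocity ω₂ p.1) /
              (groupVelocity ω₂ (φ p) - groupVelocity ω₂ (p.1 + φ p - p.2))) • ContinuousLinearMap.fst ℝ ℝ ℝ +
            ((groupVelocity ω₂ p.2 - groupVelocity ω₂ (p.1 + φ p - p.2)) /
              (groupVelocity ω₂ (φ p) - groupVelocity ω₂ (p.1 + φ p - p.2))) • ContinuousLinearMap.snd ℝ ℝ ℝ) p))) →
      ∀ a b : ℝ,
        (∀ (F : ℕ → ℝ → ℝ) (f : ℝ → ℝ), (∀ n, Function.Periodic (F n) (2 * π)) →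
          (∀ n, Measurable (F n)) → Function.Periodic f (2 * π) → Measurable f →
          (∀ᵐ k ∂(MeasureTheory.volume.restrict (Set.Ioc (-π) π)),
            Filter.Tendsto (fun n => F n k) Filter.atTop (nhds (f k))) →
          boltzmannForm ω₂ a b f ≤ Filter.liminf (fun n => boltzmannForm ω₂ a b (F n)) Filter.atTop) := by
  sorry

/-- **S4b — GAP CLOSING (pure functional analysis on `L²(cell)`; parameter-free).** If `q_{ω₂,a,b}` is convex on
periodic measurable functions (hypothesis CONV, supplied by `stub_gapClosing_partD`), lower
semicontinuous along a.e.-convergent sequences, has the odd essential gap, and has no odd `L²` null vector of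
positive norm, then `HasOddSectorGap ω₂ a b`. Why true: if no `g > 0` works, pick odd periodic measurable `f_n`
with `q(f_n) < ‖f_n‖²/(n+1)` (so `0 < ‖f_n‖² < ∞`), normalise to `‖f_n‖² = 1` (`boltzmannForm_const_mul`,
`cellNormSq_const_mul`), view in the Hilbert space `L²(cell)` and extract a weakly convergent subsequence
`f_n ⇀ u` (`Literature.Analysis.FunctionSpaces.exists_strictMono_tendsto_inner_of_norm_le`, Brezis 3.18).
If `u = 0` the subsequence is weakly null in the typed sense (pairings with `L²` test functions are inner
products) and the essential gap gives `v₀ ≤ liminf q(f_n) = 0`, absurd. If `u ≠ 0`: Banach–Saks (a further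
subsequence has strongly convergent Cesàro means `S_N → u`; elementary in Hilbert space: choose
`|⟪f_{n_i} - u, f_{n_j} - u⟫| ≤ 1/j` for `i < j`), a sub-subsequence of the function-level means converges a.e. on
the cell to a representative, which we periodise (`toIocMod`) and oddise (the means are odd; reflection
preserves null sets) into an odd periodic measurable `g` with `‖g‖² = ‖u‖² ∈ (0,∞)`; CONVEXITY of `q`
(pointwise convexity of the squared bracket, `w ≥ 0`) gives `q(S_N) ≤ N⁻¹ Σ q(f_{n_i}) → 0`, and lower
semicontinuity gives `q(g) ≤ liminf q(S_N) = 0`, contradicting the null-vector hypothesis. Size M/L.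
[folklore: direct method; Brezis2011 Thm 3.18, Cor. 3.8/Ex. 5.34 (Banach–Saks)] -/
theorem stub_gapClosing :
    ∀ ω₂ a b : ℝ,
      (∀ (f g : ℝ → ℝ) (s t : ℝ), Function.Periodic f (2 * π) → Measurable f → Function.Periodic g (2 * π) →
          Measurable g → 0 ≤ s → 0 ≤ t → s + t = 1 →
          boltzmannForm ω₂ a b (fun k => s * f k + t * g k) ≤
            ENNReal.ofReal s * boltzmannForm ω₂ a b f + ENNReal.ofReal t * boltzmannForm ω₂ a b g) →
      (∀ (F : ℕ → ℝ → ℝ) (f : ℝ → ℝ), (∀ n, Function.Periodic (F n) (2 * π)) →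
          (∀ n, Measurable (F n)) → Function.Periodic f (2 * π) → Measurable f →
          (∀ᵐ k ∂(MeasureTheory.volume.restrict (Set.Ioc (-π) π)),
            Filter.Tendsto (fun n => F n k) Filter.atTop (nhds (f k))) →
          boltzmannForm ω₂ a b f ≤ Filter.liminf (fun n => boltzmannForm ω₂ a b (F n)) Filter.atTop) →
      (∃ v₀ : ℝ, 0 < v₀ ∧
          ∀ f : ℕ → ℝ → ℝ, (∀ n, Function.Periodic (f n) (2 * π)) → (∀ n, Measurable (f n)) →
            (∀ n, Function.Odd (f n)) → (∀ n, cellNormSq (f n) = 1) →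
              (∀ φ : ℝ → ℝ, Measurable φ → cellNormSq φ < ∞ →
                  Filter.Tendsto (fun n => cellPairing φ (f n)) Filter.atTop (nhds 0)) →
                ENNReal.ofReal v₀ ≤ Filter.liminf (fun n => boltzmannForm ω₂ a b (f n)) Filter.atTop) →
      (∀ f : ℝ → ℝ, Function.Periodic f (2 * π) → Measurable f → Function.Odd f →
          cellNormSq f < ∞ → boltzmannForm ω₂ a b f = 0 → cellNormSq f = 0) →
      HasOddSectorGap ω₂ a b := by
  sorry

/-- **S4c — CONVEXITY OF THE FORM on periodic measurable functions, fed by GA** (registered as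
`stub_gapClosing_partD`; proposed and proved by the Closing worker): for the partner map `h` of GA and any
real `a b`, `q(sf + tg) ≤ s q(f) + t q(g)` (`s,t ≥ 0`, `s+t = 1`). Why a stub: the lower Lebesgue integral is
only SUPER-additive on non-measurable integrands, so convexity in integrated form needs the measurable
single-branch description of the resolved integrand `(k₁,k₃) ↦ w(k₁,h,k₃)·bracket²` (GA two-root structure,
exchange root contributes `0` for periodic functions, joint measurability of `h`); then pointwise convexity
of the square. Size M. [folklore] -/
theorem stub_gapClosing_partD :
    ∀ ω₂ : ℝ, ∀ h : ℝ → ℝ → ℝ,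
      ((∀ k₁ k₃ : ℝ, h k₁ k₃ ∈ Set.Ioc (-π) π) ∧
        (∀ k₁ k₃ : ℝ, resonanceFn ω₂ k₁ (h k₁ k₃) k₃ = 0) ∧
        (∀ k₁ k₃ : ℝ, h (k₁ + 2 * π) k₃ = h k₁ k₃ ∧ h k₁ (k₃ + 2 * π) = h k₁ k₃) ∧
        (∀ k : ℝ, k ∈ Set.Ioc (-π) π → h k k = k) ∧
        (∀ k₁ k₃ : ℝ, (∀ n : ℤ, k₃ - k₁ ≠ n * (2 * π)) →
          resonantSet ω₂ k₁ k₃ = {toIocMod Real.two_pi_pos (-π) k₃, h k₁ k₃}) ∧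
        (∀ k₁ k₃ : ℝ, (∀ n : ℤ, k₃ - k₁ ≠ n * (2 * π)) →
          (h k₁ k₃ = toIocMod Real.two_pi_pos (-π) k₃ ↔ groupVelocity ω₂ k₃ = groupVelocity ω₂ k₁)) ∧
        (∀ k₁ k₃ : ℝ, groupVelocity ω₂ k₃ ≠ groupVelocity ω₂ k₁ →
          groupVelocity ω₂ (h k₁ k₃) ≠ groupVelocity ω₂ (k₁ + h k₁ k₃ - k₃)) ∧
        Measurable (Function.uncurry h) ∧
        (∀ k₁ k₃ : ℝ, groupVelocity ω₂ k₃ ≠ groupVelocity ω₂ k₁ →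
          ∃ (φ : ℝ × ℝ → ℝ) (U : Set (ℝ × ℝ)), U ∈ 𝓝 (k₁, k₃) ∧ AnalyticOnNhd ℝ φ U ∧
            φ (k₁, k₃) = h k₁ k₃ ∧ (∀ p ∈ U, ∃ n : ℤ, φ p = h p.1 p.2 + n * (2 * π)) ∧
            (∀ p ∈ U, groupVelocity ω₂ p.2 ≠ groupVelocity ω₂ p.1) ∧
            (∀ p ∈ U, HasStrictFDerivAt φ (((groupVelocity ω₂ (p.1 + φ p - p.2) - groupVelocity ω₂ p.1) /
              (groupVelocity ω₂ (φ p) - groupVelocity ω₂ (p.1 + φ p - p.2))) • ContinuousLinearMap.fst ℝ ℝ ℝ +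
            ((groupVelocity ω₂ p.2 - groupVelocity ω₂ (p.1 + φ p - p.2)) /
              (groupVelocity ω₂ (φ p) - groupVelocity ω₂ (p.1 + φ p - p.2))) • ContinuousLinearMap.snd ℝ ℝ ℝ) p))) →
      ∀ a b : ℝ,
        (∀ (f g : ℝ → ℝ) (s t : ℝ), Function.Periodic f (2 * π) → Measurable f → Function.Periodic g (2 * π) →
          Measurable g → 0 ≤ s → 0 ≤ t → s + t = 1 →
          boltzmannForm ω₂ a b (fun k => s * f k + t * g k) ≤
            ENNReal.ofReal s * boltzmannForm ω₂ a b f + ENNReal.ofReal t * boltzmannForm ω₂ a b g) := by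
  sorry

/-! ## 1b. Helper stubs (landing vehicles for the workers' ≤400-line helper files; not used by `FGRGap_of`) -/

/-- HELPER STUB `stub_noOddC1Invariant_partA` — worker OddC1, file EmbeddedDrudeMourreFGRGapOddC1A: the explicit velocity involution σ of the pinned band (Möbius involution of cos), its range/monotonicity/involutivity, v ∘ σ = v, σ x ≠ π − x in the interior, fixed points = critical points of v. -/
theorem stub_noOddC1Invariant_partA :
    ∀ ω₂ : ℝ, 0 < ω₂ → ∃ σ : ℝ → ℝ,
      (∀ x, σ x ∈ Set.Icc 0 π) ∧ StrictAntiOn σ (Set.Icc 0 π) ∧ (∀ x ∈ Set.Icc 0 π, σ (σ x) = x) ∧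
      (∀ x ∈ Set.Ioo 0 π, σ x ∈ Set.Ioo 0 π) ∧
      (∀ x ∈ Set.Icc 0 π, groupVelocity ω₂ (σ x) = groupVelocity ω₂ x) ∧
      (∀ x ∈ Set.Ioo 0 π, σ x ≠ π - x) ∧
      (∀ x ∈ Set.Icc 0 π, (ω₂ + 2) * Real.cos (σ x) - Real.cos (σ x) ^ 2 - 1 = 0 → σ x = x) := by
  sorry

/-- HELPER STUB `stub_oddEssentialGap_partA` — lead, file EmbeddedDrudeMourreFGRGapEssGapA: unfolding a pairing against a bounded window-supported test function into a cell pairing against the folded test function. -/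
theorem stub_oddEssentialGap_partA :
    ∀ (N : ℕ) (M : ℝ) (ψ g : ℝ → ℝ), Measurable ψ → (∀ x, |ψ x| ≤ M) →
      (∀ x, x ∉ Set.Ioc (-π - N * (2 * π)) (π + N * (2 * π)) → ψ x = 0) →
      Function.Periodic g (2 * π) → Measurable g → cellNormSq g < ⊤ →
      ∫ x, ψ x * g x = cellPairing (fun x => ∑ j ∈ Finset.Icc (-(N : ℤ)) N, ψ (x + j * (2 * π))) g := by
  sorry

/-- HELPER STUB `stub_oddEssentialGap_partB` — lead, file EmbeddedDrudeMourreFGRGapEssGapB: weakly-null periodic unit sequences kill bounded kernels supported in a big square. -/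
theorem stub_oddEssentialGap_partB :
    ∀ (K : ℝ × ℝ → ℝ) (M : ℝ) (N : ℕ) (g : ℕ → ℝ → ℝ), Measurable K → (∀ p, |K p| ≤ M) →
      (∀ p, p ∉ Set.Ioc (-π - N * (2 * π)) (π + N * (2 * π)) ×ˢ Set.Ioc (-π - N * (2 * π)) (π + N * (2 * π)) →
        K p = 0) →
      (∀ n, Function.Periodic (g n) (2 * π)) → (∀ n, Measurable (g n)) → (∀ n, cellNormSq (g n) ≤ 1) →
      (∀ φ : ℝ → ℝ, Measurable φ → cellNormSq φ < ⊤ →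
        Filter.Tendsto (fun n => cellPairing φ (g n)) Filter.atTop (nhds 0)) →
      Filter.Tendsto (fun n => ∫ p, K p * (g n p.1 * g n p.2)) Filter.atTop (nhds 0) := by
  sorry

/-- HELPER STUB `stub_fibreGenericity_partA` — worker Generic, file EmbeddedDrudeMourreFGRGapGenericA: v = sin/ω analytic & non-constant, level sets of v countable/null, the equal-velocity set is null in ℝ² (Tonelli), 2π-periodicity of Ω and vertex in k₂, NoSym rigidity, s ↦ ω(s)+ω(P−s) constant on no interval, isolated-zeros ⇒ null template. -/
theorem stub_fibreGenericity_partA :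
    ∀ ω₂ : ℝ, 0 < ω₂ → MeasureTheory.volume {p : ℝ × ℝ | groupVelocity ω₂ p.2 = groupVelocity ω₂ p.1} = 0 := by
  sorry

/-- HELPER STUB `stub_fibreGenericity_partB` — worker Generic, file EmbeddedDrudeMourreFGRGapGenericB: off the equal-velocity curve v₁=v₄ and v₂=v₃ are excluded pointwise by the swap symmetries of Ω + the two-root structure. -/
theorem stub_fibreGenericity_partB :
    ∀ ω₂ : ℝ, 0 < ω₂ → ∀ h : ℝ → ℝ → ℝ, (∀ k₁ k₃ : ℝ, h k₁ k₃ ∈ Set.Ioc (-π) π) → (∀ k₁ k₃ : ℝ, resonanceFn ω₂ k₁ (h k₁ k₃) k₃ = 0) → (∀ k₁ k₃ : ℝ, (∀ n : ℤ, k₃ - k₁ ≠ n * (2 * π)) → resonantSet ω₂ k₁ k₃ = {toIocMod Real.two_pi_pos (-π) k₃, h k₁ k₃}) → (∀ k₁ k₃ : ℝ, (∀ n : ℤ, k₃ - k₁ ≠ n * (2 * π)) → (h k₁ k₃ = toIocMod Real.two_pi_pos (-π) k₃ ↔ groupVelocity ω₂ k₃ = groupVelocity ω₂ k₁)) → ∀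 k₁ k₃ : ℝ, groupVelocity ω₂ k₃ ≠ groupVelocity ω₂ k₁ → groupVelocity ω₂ (k₁ + h k₁ k₃ - k₃) ≠ groupVelocity ω₂ k₁ ∧ groupVelocity ω₂ (h k₁ k₃) ≠ groupVelocity ω₂ k₃ := by
  sorry

/-- HELPER STUB `stub_gapClosing_partA` — worker Closing, file EmbeddedDrudeMourreFGRGapClosingA: L²(cell)-convergence ⇒ an a.e.-convergent subsequence of representatives. -/
theorem stub_gapClosing_partA :
    ∀ (G : ℕ → MeasureTheory.Lp ℝ 2 (MeasureTheory.volume.restrict (Set.Ioc (-π) π))) (U : MeasureTheory.Lp ℝ 2 (MeasureTheory.volume.restrict (Set.Ioc (-π) π))) (g : ℕ → ℝ → ℝ) (r : ℝ → ℝ), Filter.Tendsto G Filter.atTop (nhds U) → (∀ n, g n =ᵐ[MeasureTheory.volume.restrict (Set.Ioc (-π) π)] G n) → r =ᵐ[MeasureTheory.volume.restrict (Set.Ioc (-π) π)] U → ∃ ns : ℕ → ℕ, StrictMono ns ∧ ∀ᵐ k ∂(MeasureTheory.volume.restrict (Set.Ioc (-π) π)), Filter.Tendsto (fun i => g (ns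 i) k) Filter.atTop (nhds (r k)) := by
  sorry

/-- HELPER STUB `stub_formLowerSemicontinuous_partB` — worker Lsc, file EmbeddedDrudeMourreFGRGapLscB: the partner map and k₄ pull 2π-invariant null sets back to null sets (submersions off the null equal-velocity curve). -/
theorem stub_formLowerSemicontinuous_partB :
    ∀ ω₂ : ℝ, 0 < ω₂ → ∀ h : ℝ → ℝ → ℝ,
      (∀ k₁ k₃ : ℝ, groupVelocity ω₂ k₃ ≠ groupVelocity ω₂ k₁ →
          groupVelocity ω₂ (h k₁ k₃) ≠ groupVelocity ω₂ (k₁ + h k₁ k₃ - k₃)) →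
      (∀ k₁ k₃ : ℝ, groupVelocity ω₂ k₃ ≠ groupVelocity ω₂ k₁ →
          ∃ (φ : ℝ × ℝ → ℝ) (U : Set (ℝ × ℝ)), U ∈ 𝓝 (k₁, k₃) ∧ AnalyticOnNhd ℝ φ U ∧
            φ (k₁, k₃) = h k₁ k₃ ∧ (∀ p ∈ U, ∃ n : ℤ, φ p = h p.1 p.2 + n * (2 * π)) ∧
            (∀ p ∈ U, groupVelocity ω₂ p.2 ≠ groupVelocity ω₂ p.1) ∧
            (∀ p ∈ U, HasStrictFDerivAt φ (((groupVelocity ω₂ (p.1 + φ p - p.2) - groupVelocity ω₂ p.1) /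
              (groupVelocity ω₂ (φ p) - groupVelocity ω₂ (p.1 + φ p - p.2))) • ContinuousLinearMap.fst ℝ ℝ ℝ +
            ((groupVelocity ω₂ p.2 - groupVelocity ω₂ (p.1 + φ p - p.2)) /
              (groupVelocity ω₂ (φ p) - groupVelocity ω₂ (p.1 + φ p - p.2))) • ContinuousLinearMap.snd ℝ ℝ ℝ) p)) →
      ∀ N : Set ℝ, MeasureTheory.volume N = 0 → (∀ (x : ℝ) (m : ℤ), x ∈ N → x + m * (2 * π) ∈ N) →
        MeasureTheory.volume {p : ℝ × ℝ | h p.1 p.2 ∈ N} = 0 ∧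
          MeasureTheory.volume {p : ℝ × ℝ | p.1 + h p.1 p.2 - p.2 ∈ N} = 0 := by
  sorry

/-- HELPER STUB `stub_branchStructure_partA` — worker Branch, file EmbeddedDrudeMourreFGRGapBranchA: two-root algebra — off the diagonal there are at most two resonant classes mod 2π; a degenerate zero is alone; a non-degenerate zero has a partner class (via the quadratic relation in cos(k₂ − (k₃−k₁)/2)). -/
theorem stub_branchStructure_partA :
    ∀ ω₂ : ℝ, 0 < ω₂ → ∀ k₁ k₃ : ℝ, ((∀ n : ℤ, k₃ - k₁ ≠ n * (2 * π)) → ∀ a b c : ℝ, resonanceFn ω₂ k₁ a k₃ = 0 → resonanceFn ω₂ k₁ b k₃ = 0 → resonanceFn ω₂ k₁ c k₃ = 0 → (∃ n : ℤ, b - a = n * (2 * π)) ∨ (∃ n : ℤ, c - a = n * (2 * π)) ∨ (∃ n : ℤ, c - b = n * (2 * π))) ∧ ((∀ n : ℤ, k₃ - k₁ ≠ n * (2 * π)) → ∀ a b : ℝ, resonanceFn ω₂ k₁ a k₃ = 0 → resonanceFn ω₂ k₁ b k₃ = 0 → groupVelocity ω₂ a = groupVelocity ω₂ (k₁ + a -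 k₃) → ∃ n : ℤ, b - a = n * (2 * π)) ∧ (∀ a : ℝ, resonanceFn ω₂ k₁ a k₃ = 0 → groupVelocity ω₂ a ≠ groupVelocity ω₂ (k₁ + a - k₃) → ∃ b : ℝ, resonanceFn ω₂ k₁ b k₃ = 0 ∧ ∀ n : ℤ, b - a ≠ n * (2 * π)) := by
  sorry

/-- HELPER STUB `stub_branchStructure_partB` — worker Branch, file EmbeddedDrudeMourreFGRGapBranchB: the partner map h with clauses (a)–(g) of the branch bundle. -/
theorem stub_branchStructure_partB :
    ∀ ω₂ : ℝ, 0 < ω₂ → ∃ h : ℝ → ℝ → ℝ, ((∀ k₁ k₃ : ℝ, h k₁ k₃ ∈ Set.Ioc (-π) π) ∧ (∀ k₁ k₃ : ℝ, resonanceFn ω₂ k₁ (h k₁ k₃) k₃ = 0) ∧ (∀ k₁ k₃ : ℝ, h (k₁ + 2 * π) k₃ = h k₁ k₃ ∧ h k₁ (k₃ + 2 * π) = h k₁ k₃) ∧ (∀ k : ℝ, k ∈ Set.Ioc (-π) π → h k k = k) ∧ (∀ k₁ k₃ : ℝ, (∀ n : ℤ, k₃ - k₁ ≠ n * (2 * π))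 → resonantSet ω₂ k₁ k₃ = {toIocMod Real.two_pi_pos (-π) k₃, h k₁ k₃}) ∧ (∀ k₁ k₃ : ℝ, (∀ n : ℤ, k₃ - k₁ ≠ n * (2 * π)) → (h k₁ k₃ = toIocMod Real.two_pi_pos (-π) k₃ ↔ groupVelocity ω₂ k₃ = groupVelocity ω₂ k₁)) ∧ (∀ k₁ k₃ : ℝ, groupVelocity ω₂ k₃ ≠ groupVelocity ω₂ k₁ → groupVelocity ω₂ (h k₁ k₃) ≠ groupVelocity ω₂ (k₁ + h k₁ k₃ - k₃))) := by
  sorry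

/-- HELPER STUB `stub_branchStructure_partC` — worker Branch, file EmbeddedDrudeMourreFGRGapBranchC: analytic implicit-function lift at a simple resonant root, with the implicit derivative. -/
theorem stub_branchStructure_partC :
    ∀ ω₂ : ℝ, 0 < ω₂ → ∀ a b y₀ : ℝ, resonanceFn ω₂ a y₀ b = 0 → groupVelocity ω₂ y₀ ≠ groupVelocity ω₂ (a + y₀ - b) → ∃ φ : ℝ × ℝ → ℝ, φ (a, b) = y₀ ∧ AnalyticAt ℝ φ (a, b) ∧ (∀ᶠ p in 𝓝 (a, b), resonanceFn ω₂ p.1 (φ p) p.2 = 0) ∧ (∀ᶠ p in 𝓝 (a, b), HasStrictFDerivAt φ (((groupVelocity ω₂ (p.1 + φ p - p.2) - groupVelocity ω₂ p.1) / (groupVelocity ω₂ (φ p) - groupVelocity ω₂ (p.1 + φ p - p.2))) • ContinuousLinearMap.fst ℝ ℝ ℝ + ((groupVelocity ω₂ p.2 - groupVelocity ω₂ (p.1 + φ p - p.2)) / (groupVelocity ω₂ (φ p) - groupVelocity ω₂ (p.1 + φ p - p.2))) • ContinuousLinearMap.snd ℝ ℝ ℝ) p) := by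
  sorry

/-- HELPER STUB `stub_nullVectorRegularity_partA` — worker Bootstrap, file EmbeddedDrudeMourreFGRGapBootstrapA: form zero ⇒ the four-point identity holds a.e. in ℝ². -/
theorem stub_nullVectorRegularity_partA :
    ∀ ω₂ a b : ℝ, 0 < ω₂ → ∀ h : ℝ → ℝ → ℝ, (∀ k₁ k₃ : ℝ, h (k₁ + 2 * π) k₃ = h k₁ k₃ ∧ h k₁ (k₃ + 2 * π) = h k₁ k₃) → (∀ k₁ k₃ : ℝ, (∀ n : ℤ, k₃ - k₁ ≠ n * (2 * π)) → resonantSet ω₂ k₁ k₃ = {toIocMod Real.two_pi_pos (-π) k₃, h k₁ k₃}) → (∀ k₁ k₃ : ℝ, groupVelocity ω₂ k₃ ≠ groupVelocity ω₂ k₁ → groupVelocity ω₂ (h k₁ k₃) ≠ groupVelocity ω₂ (k₁ + h k₁ k₃ - k₃)) → Measurable (Function.uncurry h) → MeasureTheory.volume {p : ℝ × ℝ | groupVelocity ω₂ p.2 = groupVelocity ω₂ p.1} = 0 → MeasureTheory.volume {p : ℝ × ℝ | vertex a b p.1 (h p.1 p.2) p.2 = 0} = 0 → ∀ f : ℝ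 → ℝ, Function.Periodic f (2 * π) → Measurable f → boltzmannForm ω₂ a b f = 0 → ∀ᵐ p : ℝ × ℝ, f p.1 + f (h p.1 p.2) = f p.2 + f (p.1 + h p.1 p.2 - p.2) := by
  sorry

/-- HELPER STUB `stub_nullVectorRegularity_partB` — worker Bootstrap, file EmbeddedDrudeMourreFGRGapBootstrapB: 2D inverse-function chart for (a,y) ↦ (a, Φ(a,y)) with ∂₂Φ ≠ 0 and the Jacobian kernel Θ of a bump χ. -/
theorem stub_nullVectorRegularity_partB :
    ∀ (Φ : ℝ × ℝ → ℝ) (p₀ : ℝ × ℝ) (V : Set (ℝ × ℝ)), IsOpen V → p₀ ∈ V → ContDiffOn ℝ ((⊤ : ℕ∞) : WithTop ℕ∞) Φ V → fderiv ℝ Φ p₀ (0, 1) ≠ 0 → ∃ ε : ℝ, 0 < ε ∧ Metric.closedBall p₀ ε ⊆ V ∧ (∀ a ∈ Set.Ioo (p₀.1 - ε) (p₀.1 + ε), Set.InjOn (fun y => Φ (a, y)) (Set.Ioo (p₀.2 - ε) (p₀.2 + ε))) ∧ ∀ χ : ℝ → ℝ, ContDiff ℝ ((⊤ : ℕ∞)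 : WithTop ℕ∞) χ → HasCompactSupport χ → tsupport χ ⊆ Set.Ioo (p₀.2 - ε) (p₀.2 + ε) → ∃ Θ : ℝ × ℝ → ℝ, ContDiff ℝ ((⊤ : ℕ∞) : WithTop ℕ∞) Θ ∧ (∀ q, Θ q ≠ 0 → q.2 ∈ Φ '' Metric.closedBall p₀ ε) ∧ (∃ C : ℝ, ∀ q, |Θ q| ≤ C) ∧ (∀ a ∈ Set.Ioo (p₀.1 - ε / 2) (p₀.1 + ε / 2), ∀ y ∈ Set.Ioo (p₀.2 - ε) (p₀.2 + ε), Θ (a, Φ (a, y)) * |fderiv ℝ Φ (a, y) (0, 1)| = χ y) ∧ (∀ a ∈ Set.Ioo (p₀.1 - ε / 2) (p₀.1 + ε / 2), ∀ u : ℝ, Θ (a, u) ≠ 0 → u ∈ (fun y => Φ (a, y)) '' Set.Ioo (p₀.2 - ε) (p₀.2 + ε)) := by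
  sorry

/-- HELPER STUB `stub_nullVectorRegularity_partC` — worker Bootstrap, file EmbeddedDrudeMourreFGRGapBootstrapC: THE CORE LEMMA — a ↦ ∫ χ(y) f(Φ(a,y)) dy is locally C^∞ for f ∈ L¹_loc. -/
theorem stub_nullVectorRegularity_partC :
    ∀ (Φ : ℝ × ℝ → ℝ) (p₀ : ℝ × ℝ) (V : Set (ℝ × ℝ)), IsOpen V → p₀ ∈ V → ContDiffOn ℝ ((⊤ : ℕ∞) : WithTop ℕ∞) Φ V → fderiv ℝ Φ p₀ (0, 1) ≠ 0 → ∃ ε : ℝ, 0 < ε ∧ ∀ χ : ℝ → ℝ, ContDiff ℝ ((⊤ : ℕ∞) : WithTop ℕ∞) χ → HasCompactSupport χ → tsupport χ ⊆ Set.Ioo (p₀.2 - ε) (p₀.2 + ε) → ∀ f : ℝ → ℝ, MeasureTheory.LocallyIntegrable f MeasureTheory.volume → (∀ a ∈ Set.Ioo (p₀.1 - ε) (p₀.1 + ε), MeasureTheory.Integrable (fun y => χ y * f (Φ (a, y))) MeasureTheory.volume) ∧ ∃ R : ℝ → ℝ, ContDiff ℝ ((⊤ : ℕ∞) : WithTop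 ℕ∞) R ∧ ∀ a ∈ Set.Ioo (p₀.1 - ε) (p₀.1 + ε), R a = ∫ y, χ y * f (Φ (a, y)) := by
  sorry

/-- HELPER STUB `stub_nullVectorRegularity_partL` — worker Bootstrap, file EmbeddedDrudeMourreFGRGapBootstrapL: LOCAL SMOOTH REPRESENTATIVE — around every k₀ the a.e. four-point identity makes f agree a.e. with a C^∞ function (averaging against a bump along k₃ ↦ φ, k₄ at a general-position window). -/
theorem stub_nullVectorRegularity_partL :
    ∀ ω₂ : ℝ, ∀ h : ℝ → ℝ → ℝ, (∀ k₁ k₃ : ℝ, groupVelocity ω₂ k₃ ≠ groupVelocity ω₂ k₁ → ∃ (φ : ℝ × ℝ → ℝ) (U : Set (ℝ × ℝ)), U ∈ 𝓝 (k₁, k₃) ∧ AnalyticOnNhd ℝ φ U ∧ φ (k₁, k₃) = h k₁ k₃ ∧ (∀ p ∈ U, ∃ n : ℤ, φ p = h p.1 p.2 + n * (2 * π)) ∧ (∀ p ∈ U, groupVelocity ω₂ p.2 ≠ groupVelocity ω₂ p.1) ∧ (∀ p ∈ U, HasStrictFDerivAt φ (((groupVelocity ω₂ (p.1 + φ p -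 p.2) - groupVelocity ω₂ p.1) / (groupVelocity ω₂ (φ p) - groupVelocity ω₂ (p.1 + φ p - p.2))) • ContinuousLinearMap.fst ℝ ℝ ℝ + ((groupVelocity ω₂ p.2 - groupVelocity ω₂ (p.1 + φ p - p.2)) / (groupVelocity ω₂ (φ p) - groupVelocity ω₂ (p.1 + φ p - p.2))) • ContinuousLinearMap.snd ℝ ℝ ℝ) p)) → (∀ k₁ r : ℝ, 0 ≤ r → ∃ k₃ : ℝ, groupVelocity ω₂ k₁ ≠ groupVelocity ω₂ (h k₁ k₃) ∧ groupVelocity ω₂ k₁ ≠ groupVelocity ω₂ k₃ ∧ groupVelocity ω₂ k₁ ≠ groupVelocity ω₂ (k₁ + h k₁ k₃ - k₃) ∧ groupVelocity ω₂ (h k₁ k₃) ≠ groupVelocity ω₂ k₃ ∧ groupVelocity ω₂ (h k₁ k₃) ≠ groupVelocity ω₂ (k₁ + h k₁ k₃ - k₃) ∧ groupVelocity ω₂ k₃ ≠ groupVelocity ω₂ (k₁ + h k₁ k₃ - k₃) ∧ vertex 1 r k₁ (h k₁ k₃) k₃ ≠ 0) → ∀ f : ℝ → ℝ, Function.Periodic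 f (2 * π) → MeasureTheory.LocallyIntegrable f MeasureTheory.volume → (∀ᵐ p : ℝ × ℝ, f p.1 + f (h p.1 p.2) = f p.2 + f (p.1 + h p.1 p.2 - p.2)) → ∀ k₀ : ℝ, ∃ ε : ℝ, 0 < ε ∧ ∃ R : ℝ → ℝ, ContDiff ℝ ((⊤ : ℕ∞) : WithTop ℕ∞) R ∧ ∀ᵐ a : ℝ, a ∈ Set.Ioo (k₀ - ε) (k₀ + ε) → f a = R a := by
  sorry

/-- HELPER STUB `stub_nullVectorRegularity_partD` — worker Bootstrap, file EmbeddedDrudeMourreFGRGapBootstrapD: INVARIANCE EVERYWHERE — a continuous periodic representative satisfying the four-point identity a.e. is a collisional invariant at every real resonance (submersion pull-backs + two-root structure + periodicity). -/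
theorem stub_nullVectorRegularity_partD :
    ∀ ω₂ : ℝ, ∀ h : ℝ → ℝ → ℝ, (∀ k₁ k₃ : ℝ, (∀ n : ℤ, k₃ - k₁ ≠ n * (2 * π)) → resonantSet ω₂ k₁ k₃ = {toIocMod Real.two_pi_pos (-π) k₃, h k₁ k₃}) → (∀ k₁ k₃ : ℝ, (∀ n : ℤ, k₃ - k₁ ≠ n * (2 * π)) → (h k₁ k₃ = toIocMod Real.two_pi_pos (-π) k₃ ↔ groupVelocity ω₂ k₃ = groupVelocity ω₂ k₁)) → (∀ k₁ k₃ : ℝ, groupVelocity ω₂ k₃ ≠ groupVelocity ω₂ k₁ → groupVelocity ω₂ (h k₁ k₃) ≠ groupVelocity ω₂ (k₁ + h k₁ k₃ - k₃)) → (∀ k₁ k₃ : ℝ, groupVelocity ω₂ k₃ ≠ groupVelocity ω₂ k₁ → ∃ (φ : ℝ × ℝ → ℝ) (U : Set (ℝ × ℝ)), U ∈ 𝓝 (k₁, k₃) ∧ AnalyticOnNhd ℝ φ U ∧ φ (k₁, k₃) = h k₁ k₃ ∧ (∀ p ∈ U, ∃ n : ℤ, φ p = h p.1 p.2 + n * (2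 * π)) ∧ (∀ p ∈ U, groupVelocity ω₂ p.2 ≠ groupVelocity ω₂ p.1) ∧ (∀ p ∈ U, HasStrictFDerivAt φ (((groupVelocity ω₂ (p.1 + φ p - p.2) - groupVelocity ω₂ p.1) / (groupVelocity ω₂ (φ p) - groupVelocity ω₂ (p.1 + φ p - p.2))) • ContinuousLinearMap.fst ℝ ℝ ℝ + ((groupVelocity ω₂ p.2 - groupVelocity ω₂ (p.1 + φ p - p.2)) / (groupVelocity ω₂ (φ p) - groupVelocity ω₂ (p.1 + φ p - p.2))) • ContinuousLinearMap.snd ℝ ℝ ℝ) p)) → ∀ f g : ℝ → ℝ, Function.Periodic f (2 * π) → Function.Periodic g (2 * π) → Continuous g → (∀ᵐ x : ℝ, f x = g x) → (∀ᵐ p : ℝ × ℝ, f p.1 + f (h p.1 p.2) = f p.2 + f (p.1 + h p.1 p.2 - p.2)) → IsCollisionalInvariant ω₂ g := by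
  sorry

/-- HELPER STUB `stub_oddEssentialGap_partC` — lead, file EmbeddedDrudeMourreFGRGapEssGapC: the form dominates a quarter of the h-branch integrand over any rectangle with sides < 2π (periodic unfolding of q onto the partner branch). -/
theorem stub_oddEssentialGap_partC :
    ∀ (ω₂ : ℝ) (h : ℝ → ℝ → ℝ), (∀ k₁ k₃ : ℝ, resonanceFn ω₂ k₁ (h k₁ k₃) k₃ = 0) →
      (∀ k₁ k₃ : ℝ, h (k₁ + 2 * π) k₃ = h k₁ k₃ ∧ h k₁ (k₃ + 2 * π) = h k₁ k₃) →
      (∀ k₁ k₃ : ℝ, (∀ n : ℤ, k₃ - k₁ ≠ n * (2 * π)) →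
        resonantSet ω₂ k₁ k₃ = {toIocMod Real.two_pi_pos (-π) k₃, h k₁ k₃}) →
      ∀ (a b : ℝ) (f : ℝ → ℝ), Function.Periodic f (2 * π) → ∀ α β γ δ : ℝ, β - α < 2 * π → δ - γ < 2 * π →
        ENNReal.ofReal (1 / 4) * ∫⁻ p in Set.Icc α β ×ˢ Set.Icc γ δ, ENNReal.ofReal
            (collisionWeight ω₂ a b p.1 (h p.1 p.2) p.2 *
              (f p.1 + f (h p.1 p.2) - f p.2 - f (p.1 + h p.1 p.2 - p.2)) ^ 2)
            ∂(MeasureTheory.volume.prod MeasureTheory.volume) ≤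
          boltzmannForm ω₂ a b f := by
  sorry

/-- HELPER STUB `stub_oddEssentialGap_partD` — lead, file EmbeddedDrudeMourreFGRGapEssGapD: abstract chart integrals ∫_R W·g(e p)₁·g(e p)₂ are kernel forms and die along weakly-null sequences; window-square L² bounds of pulled-back coordinates. -/
theorem stub_oddEssentialGap_partD :
    ∀ (g : ℝ → ℝ) (N : ℕ), Function.Periodic g (2 * π) → cellNormSq g ≤ 1 →
      ∫⁻ q in Set.Ioc (-π - N * (2 * π)) (π + N * (2 * π)) ×ˢ Set.Ioc (-π - N * (2 * π)) (π + N * (2 * π)),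
          ENNReal.ofReal (g q.2 ^ 2) ∂(MeasureTheory.volume.prod MeasureTheory.volume) ≤
        ENNReal.ofReal ((2 * N + 1) * (2 * π)) * (2 * N + 1) := by
  sorry

/-- HELPER STUB `stub_oddEssentialGap_partE` — lead, file EmbeddedDrudeMourreFGRGapEssGapE: coordinate-pair charts (p ↦ (p.1, φ p), p ↦ (p.1, p.1 + φ p − p.2)) as OpenPartialHomeomorphs with explicit Jacobians; continuity and positivity of the collision weight off the Jacobian-degenerate set. -/
theorem stub_oddEssentialGap_partE :
    ∀ ω₂ : ℝ, 0 < ω₂ → ∀ (a b : ℝ) (q : ℝ × ℝ × ℝ),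
      groupVelocity ω₂ q.2.1 ≠ groupVelocity ω₂ (q.1 + q.2.1 - q.2.2) →
        ContinuousAt (fun q : ℝ × ℝ × ℝ => collisionWeight ω₂ a b q.1 q.2.1 q.2.2) q := by
  sorry

/-- HELPER STUB `stub_oddEssentialGap_partF` — lead, file EmbeddedDrudeMourreFGRGapEssGapF: the good rectangle around a general-position fibre point — analytic lift of h, both charts with Jacobians bounded away from 0, collision weight pinched in [w₀, 4w₀], everything inside one window square. -/
theorem stub_oddEssentialGap_partF :
    ∀ ω₂ : ℝ, 0 < ω₂ → ∀ h : ℝ → ℝ → ℝ,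
      (∀ k₁ k₃ : ℝ, groupVelocity ω₂ k₃ ≠ groupVelocity ω₂ k₁ →
        ∃ (φ : ℝ × ℝ → ℝ) (U : Set (ℝ × ℝ)), U ∈ 𝓝 (k₁, k₃) ∧ AnalyticOnNhd ℝ φ U ∧
          φ (k₁, k₃) = h k₁ k₃ ∧ (∀ p ∈ U, ∃ n : ℤ, φ p = h p.1 p.2 + n * (2 * π)) ∧
          (∀ p ∈ U, groupVelocity ω₂ p.2 ≠ groupVelocity ω₂ p.1) ∧
          (∀ p ∈ U, HasStrictFDerivAt φ
            (((groupVelocity ω₂ (p.1 + φ p - p.2) - groupVelocity ω₂ p.1) /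
                (groupVelocity ω₂ (φ p) - groupVelocity ω₂ (p.1 + φ p - p.2))) •
                ContinuousLinearMap.fst ℝ ℝ ℝ +
              ((groupVelocity ω₂ p.2 - groupVelocity ω₂ (p.1 + φ p - p.2)) /
                (groupVelocity ω₂ (φ p) - groupVelocity ω₂ (p.1 + φ p - p.2))) •
                ContinuousLinearMap.snd ℝ ℝ ℝ) p)) →
      (∀ k₁ r : ℝ, 0 ≤ r → ∃ k₃ : ℝ,
        (groupVelocity ω₂ k₁ ≠ groupVelocity ω₂ (h k₁ k₃) ∧ groupVelocity ω₂ k₁ ≠ groupVelocity ω₂ k₃ ∧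
          groupVelocity ω₂ k₁ ≠ groupVelocity ω₂ (k₁ + h k₁ k₃ - k₃) ∧
            groupVelocity ω₂ (h k₁ k₃) ≠ groupVelocity ω₂ k₃ ∧
          groupVelocity ω₂ (h k₁ k₃) ≠ groupVelocity ω₂ (k₁ + h k₁ k₃ - k₃) ∧
            groupVelocity ω₂ k₃ ≠ groupVelocity ω₂ (k₁ + h k₁ k₃ - k₃)) ∧
        vertex 1 r k₁ (h k₁ k₃) k₃ ≠ 0) →
      ∀ a b : ℝ, 0 < a → 0 ≤ b → ∀ x₀ : ℝ,
      ∃ (ε y₀ : ℝ) (φ c₃ : ℝ × ℝ → ℝ) (e₂ e₄ : OpenPartialHomeomorph (ℝ × ℝ) (ℝ × ℝ)) (w₀ δ : ℝ) (N : ℕ)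
        (R : Set (ℝ × ℝ)),
        R = Set.Icc (x₀ - ε) (x₀ + ε) ×ˢ Set.Icc (y₀ - ε) (y₀ + ε) ∧ 0 < ε ∧ ε ≤ 1 ∧ 0 < w₀ ∧ 0 < δ ∧
        (∀ p ∈ R, ∃ n : ℤ, φ p = h p.1 p.2 + n * (2 * π)) ∧
        (∀ p ∈ R, c₃ p = (groupVelocity ω₂ p.2 - groupVelocity ω₂ (p.1 + φ p - p.2)) /
          (groupVelocity ω₂ (φ p) - groupVelocity ω₂ (p.1 + φ p - p.2))) ∧
        (∀ p ∈ R, HasStrictFDerivAt φ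
          (((groupVelocity ω₂ (p.1 + φ p - p.2) - groupVelocity ω₂ p.1) /
              (groupVelocity ω₂ (φ p) - groupVelocity ω₂ (p.1 + φ p - p.2))) •
              ContinuousLinearMap.fst ℝ ℝ ℝ + c₃ p • ContinuousLinearMap.snd ℝ ℝ ℝ) p) ∧
        ContinuousOn φ R ∧ ContinuousOn c₃ R ∧
        (∀ p, e₂ p = (p.1, φ p)) ∧ (∀ p, e₄ p = (p.1, p.1 + φ p - p.2)) ∧
        R ⊆ e₂.source ∧ R ⊆ e₄.source ∧
        (∀ p ∈ R, δ ≤ |c₃ p|) ∧ (∀ p ∈ R, δ ≤ |c₃ p - 1|) ∧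
        (∀ p ∈ R, w₀ ≤ collisionWeight ω₂ a b p.1 (φ p) p.2 ∧
          collisionWeight ω₂ a b p.1 (φ p) p.2 ≤ 4 * w₀) ∧
        ContinuousOn (fun p => collisionWeight ω₂ a b p.1 (φ p) p.2) R ∧
        R ⊆ Set.Ioc (-π - N * (2 * π)) (π + N * (2 * π)) ×ˢ Set.Ioc (-π - N * (2 * π)) (π + N * (2 * π)) ∧
        e₂ '' R ⊆ Set.Ioc (-π - N * (2 * π)) (π + N * (2 * π)) ×ˢ Set.Ioc (-π - N * (2 * π)) (π + N * (2 * π)) ∧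
        e₄ '' R ⊆ Set.Ioc (-π - N * (2 * π)) (π + N * (2 * π)) ×ˢ Set.Ioc (-π - N * (2 * π)) (π + N * (2 * π)) := by
  sorry

/-- HELPER STUB `stub_oddEssentialGap_partG` — lead, file EmbeddedDrudeMourreFGRGapEssGapG: the local coercivity estimate ¼·ofReal(c ∫_{[x₀−ε,x₀+ε]} g² + X g) ≤ q(g) near every base momentum, with X dying along weakly-null sequences. -/
theorem stub_oddEssentialGap_partG :
    ∀ ω₂ : ℝ, 0 < ω₂ → ∀ h : ℝ → ℝ → ℝ,
      (∀ k₁ k₃ : ℝ, resonanceFn ω₂ k₁ (h k₁ k₃) k₃ = 0) →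
      (∀ k₁ k₃ : ℝ, h (k₁ + 2 * π) k₃ = h k₁ k₃ ∧ h k₁ (k₃ + 2 * π) = h k₁ k₃) →
      (∀ k₁ k₃ : ℝ, (∀ n : ℤ, k₃ - k₁ ≠ n * (2 * π)) →
        resonantSet ω₂ k₁ k₃ = {toIocMod Real.two_pi_pos (-π) k₃, h k₁ k₃}) →
      (∀ k₁ k₃ : ℝ, groupVelocity ω₂ k₃ ≠ groupVelocity ω₂ k₁ →
        ∃ (φ : ℝ × ℝ → ℝ) (U : Set (ℝ × ℝ)), U ∈ 𝓝 (k₁, k₃) ∧ AnalyticOnNhd ℝ φ U ∧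
          φ (k₁, k₃) = h k₁ k₃ ∧ (∀ p ∈ U, ∃ n : ℤ, φ p = h p.1 p.2 + n * (2 * π)) ∧
          (∀ p ∈ U, groupVelocity ω₂ p.2 ≠ groupVelocity ω₂ p.1) ∧
          (∀ p ∈ U, HasStrictFDerivAt φ
            (((groupVelocity ω₂ (p.1 + φ p - p.2) - groupVelocity ω₂ p.1) /
                (groupVelocity ω₂ (φ p) - groupVelocity ω₂ (p.1 + φ p - p.2))) •
                ContinuousLinearMap.fst ℝ ℝ ℝ +
              ((groupVelocity ω₂ p.2 - groupVelocity ω₂ (p.1 + φ p - p.2)) /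
                (groupVelocity ω₂ (φ p) - groupVelocity ω₂ (p.1 + φ p - p.2))) •
                ContinuousLinearMap.snd ℝ ℝ ℝ) p)) →
      (∀ k₁ r : ℝ, 0 ≤ r → ∃ k₃ : ℝ,
        (groupVelocity ω₂ k₁ ≠ groupVelocity ω₂ (h k₁ k₃) ∧ groupVelocity ω₂ k₁ ≠ groupVelocity ω₂ k₃ ∧
          groupVelocity ω₂ k₁ ≠ groupVelocity ω₂ (k₁ + h k₁ k₃ - k₃) ∧
            groupVelocity ω₂ (h k₁ k₃) ≠ groupVelocity ω₂ k₃ ∧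
          groupVelocity ω₂ (h k₁ k₃) ≠ groupVelocity ω₂ (k₁ + h k₁ k₃ - k₃) ∧
            groupVelocity ω₂ k₃ ≠ groupVelocity ω₂ (k₁ + h k₁ k₃ - k₃)) ∧
        vertex 1 r k₁ (h k₁ k₃) k₃ ≠ 0) →
      ∀ a b : ℝ, 0 < a → 0 ≤ b → ∀ x₀ : ℝ,
      ∃ ε : ℝ, 0 < ε ∧ ∃ c : ℝ, 0 < c ∧ ∃ X : (ℝ → ℝ) → ℝ,
        (∀ g : ℝ → ℝ, Function.Periodic g (2 * π) → Measurable g → cellNormSq g ≤ 1 →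
          ENNReal.ofReal (1 / 4) * ENNReal.ofReal (c * (∫ x in Set.Icc (x₀ - ε) (x₀ + ε), g x ^ 2) + X g) ≤
            boltzmannForm ω₂ a b g) ∧
        (∀ g : ℕ → ℝ → ℝ, (∀ n, Function.Periodic (g n) (2 * π)) → (∀ n, Measurable (g n)) →
          (∀ n, cellNormSq (g n) ≤ 1) →
          (∀ φ : ℝ → ℝ, Measurable φ → cellNormSq φ < ⊤ →
            Filter.Tendsto (fun n => cellPairing φ (g n)) Filter.atTop (nhds 0)) →
          Filter.Tendsto (fun n => X (g n)) Filter.atTop (nhds 0)) := by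
  sorry

/-! ## 2. The composition (kernel-checked; no `sorry` of its own)

`FGRGap_of : FGRGap`, assembled from the seven registered stubs directly. -/

/-- S2 + S1 (fed by GA, GB): the form has no odd `L²` null vector of positive norm (`0 < a`, `0 ≤ b`). -/
theorem noOddNullVector {ω₂ a b : ℝ} (hω : 0 < ω₂) (ha : 0 < a) (hb : 0 ≤ b) (h : ℝ → ℝ → ℝ)
    (hB : ((∀ k₁ k₃ : ℝ, h k₁ k₃ ∈ Set.Ioc (-π) π) ∧
        (∀ k₁ k₃ : ℝ, resonanceFn ω₂ k₁ (h k₁ k₃) k₃ = 0) ∧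
        (∀ k₁ k₃ : ℝ, h (k₁ + 2 * π) k₃ = h k₁ k₃ ∧ h k₁ (k₃ + 2 * π) = h k₁ k₃) ∧
        (∀ k : ℝ, k ∈ Set.Ioc (-π) π → h k k = k) ∧
        (∀ k₁ k₃ : ℝ, (∀ n : ℤ, k₃ - k₁ ≠ n * (2 * π)) →
          resonantSet ω₂ k₁ k₃ = {toIocMod Real.two_pi_pos (-π) k₃, h k₁ k₃}) ∧
        (∀ k₁ k₃ : ℝ, (∀ n : ℤ, k₃ - k₁ ≠ n * (2 * π)) →
          (h k₁ k₃ = toIocMod Real.two_pi_pos (-π) k₃ ↔ groupVelocity ω₂ k₃ = groupVelocity ω₂ k₁)) ∧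
        (∀ k₁ k₃ : ℝ, groupVelocity ω₂ k₃ ≠ groupVelocity ω₂ k₁ →
          groupVelocity ω₂ (h k₁ k₃) ≠ groupVelocity ω₂ (k₁ + h k₁ k₃ - k₃)) ∧
        Measurable (Function.uncurry h) ∧
        (∀ k₁ k₃ : ℝ, groupVelocity ω₂ k₃ ≠ groupVelocity ω₂ k₁ →
          ∃ (φ : ℝ × ℝ → ℝ) (U : Set (ℝ × ℝ)), U ∈ 𝓝 (k₁, k₃) ∧ AnalyticOnNhd ℝ φ U ∧
            φ (k₁, k₃) = h k₁ k₃ ∧ (∀ p ∈ U, ∃ n : ℤ, φ p = h p.1 p.2 + n * (2 * π)) ∧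
            (∀ p ∈ U, groupVelocity ω₂ p.2 ≠ groupVelocity ω₂ p.1) ∧
            (∀ p ∈ U, HasStrictFDerivAt φ (((groupVelocity ω₂ (p.1 + φ p - p.2) - groupVelocity ω₂ p.1) /
              (groupVelocity ω₂ (φ p) - groupVelocity ω₂ (p.1 + φ p - p.2))) • ContinuousLinearMap.fst ℝ ℝ ℝ +
            ((groupVelocity ω₂ p.2 - groupVelocity ω₂ (p.1 + φ p - p.2)) /
              (groupVelocity ω₂ (φ p) - groupVelocity ω₂ (p.1 + φ p - p.2))) • ContinuousLinearMap.snd ℝ ℝ ℝ) p))))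
    (hC : ((∀ k₁ r : ℝ, 0 ≤ r → ∃ k₃ : ℝ,
          groupVelocity ω₂ k₁ ≠ groupVelocity ω₂ (h k₁ k₃) ∧ groupVelocity ω₂ k₁ ≠ groupVelocity ω₂ k₃ ∧
          groupVelocity ω₂ k₁ ≠ groupVelocity ω₂ (k₁ + h k₁ k₃ - k₃) ∧ groupVelocity ω₂ (h k₁ k₃) ≠ groupVelocity ω₂ k₃ ∧
          groupVelocity ω₂ (h k₁ k₃) ≠ groupVelocity ω₂ (k₁ + h k₁ k₃ - k₃) ∧ groupVelocity ω₂ k₃ ≠ groupVelocity ω₂ (k₁ + h k₁ k₃ - k₃) ∧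
          vertex 1 r k₁ (h k₁ k₃) k₃ ≠ 0) ∧
        MeasureTheory.volume {p : ℝ × ℝ | groupVelocity ω₂ p.2 = groupVelocity ω₂ p.1} = 0 ∧
        (∀ a b : ℝ, 0 < a → 0 ≤ b →
          MeasureTheory.volume {p : ℝ × ℝ | vertex a b p.1 (h p.1 p.2) p.2 = 0} = 0))) :
    (∀ f : ℝ → ℝ, Function.Periodic f (2 * π) → Measurable f → Function.Odd f →
          cellNormSq f < ∞ → boltzmannForm ω₂ a b f = 0 → cellNormSq f = 0) := by
  intro f hper hmeas hodd hfin hq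
  obtain ⟨ψ, hC1, hψper, hψodd, hinv, hae⟩ :=
    stub_nullVectorRegularity ω₂ hω h hB hC a b ha hb f hper hmeas hodd hfin hq
  have hψ0 : ∀ k : ℝ, ψ k = 0 := stub_noOddC1Invariant ω₂ hω ψ hC1 hψper hψodd hinv
  have hf0 : (fun k => ENNReal.ofReal (f k ^ 2)) =ᵐ[volume.restrict (Set.Ioc (-π) π)]
      fun _ => (0 : ℝ≥0∞) :=
    hae.mono fun k hk => by
      show ENNReal.ofReal (f k ^ 2) = 0
      rw [hk, hψ0 k]
      simp
  unfold cellNormSq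
  calc ∫⁻ k in Set.Ioc (-π) π, ENNReal.ofReal (f k ^ 2)
      = ∫⁻ _ in Set.Ioc (-π) π, (0 : ℝ≥0∞) := lintegral_congr_ae hf0
    _ = 0 := lintegral_zero

/-- All stubs together: the odd-sector gap for `ω₂ > 0`, `a > 0` and every `b ≥ 0` (so the line also yields
ALS's on-site model `b = 0`, which the crux needs by `onsite_of_crux`). -/
theorem hasOddSectorGap_of_stubs (ω₂ a b : ℝ) (hω : 0 < ω₂) (ha : 0 < a) (hb : 0 ≤ b) :
    HasOddSectorGap ω₂ a b := by
  obtain ⟨h, hB⟩ := stub_branchStructure ω₂ hω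
  have hC := stub_fibreGenericity ω₂ hω h hB
  exact stub_gapClosing ω₂ a b (stub_gapClosing_partD ω₂ h hB a b)
    (stub_formLowerSemicontinuous ω₂ hω h hB a b)
    (stub_oddEssentialGap ω₂ hω h hB hC a b ha hb) (noOddNullVector hω ha hb h hB hC)

/-- **The line concludes the crux BY NAME** (modulo the seven registered stubs). -/
theorem FGRGap_of : Summit.AtomisticToContinuum.FouriersLaw.Theses.EmbeddedDrudeMourre.FGRGap :=
  fgrGap_iff.mpr fun ω₂ a b hω ha hb => hasOddSectorGap_of_stubs ω₂ a b hω ha hb.le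

/-! ## 3. Checks against the landed Negative lemmas (imported) -/

/-- Consistency with `Negative.OnsiteReduction.onsite_of_crux` (the `b = 0` gap is NECESSARY for the
crux): the stubs deliver it directly. -/
example {ω₂ : ℝ} (hω : 0 < ω₂) : HasOddSectorGap ω₂ 1 0 :=
  hasOddSectorGap_of_stubs ω₂ 1 0 hω one_pos le_rfl

example : Summit.AtomisticToContinuum.FouriersLaw.Theses.EmbeddedDrudeMourre.FGRGap →
    ∀ ω₂ : ℝ, 0 < ω₂ → HasOddSectorGap ω₂ 1 0 :=
  fun h _ hω => Negative.OnsiteReduction.onsite_of_crux h hω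

/-- The null-vector hypothesis of S4b is where the couplings enter: for the harmonic vertex `a = b = 0` it is
FALSE (`sin` is an odd null vector of positive norm), matching `crux_false_without_couplings`. -/
example (ω₂ : ℝ) :
    ¬ ∀ f : ℝ → ℝ, Function.Periodic f (2 * π) → Measurable f → Function.Odd f →
        cellNormSq f < ∞ → boltzmannForm ω₂ 0 0 f = 0 → cellNormSq f = 0 := fun h =>
  Negative.LoadBearing.cellNormSq_sin_pos.ne'
    (h Real.sin Real.sin_periodic Real.measurable_sin (fun k => Real.sin_neg k)
      Negative.LoadBearing.cellNormSq_sin_lt_top (Negative.LoadBearing.boltzmannForm_zero_zero ω₂ Real.sin))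

/-- `0 < a` cannot be dropped (both couplings dropped is refuted outright). -/
example : ¬ ∀ ω₂ a b : ℝ, 0 < ω₂ → HasOddSectorGap ω₂ a b :=
  Negative.LoadBearing.crux_false_without_couplings

end Summit.AtomisticToContinuum.FouriersLaw.Cruxes.FGRGap.FoldJetRigidity

end
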